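import Mathlib.Analysis.SpecialFunctions.PolarCoord
import Mathlib.Analysis.SpecialFunctions.Log.Basic
import Mathlib.MeasureTheory.Group.Prod
import Mathlib.MeasureTheory.Integral.Prod
import Mathlib.MeasureTheory.Function.LocallyIntegrable

/-!
# Local integrability of the planar logarithmic kernel

**Facts (classical).** `z ↦ log |z|` is integrable on every disc of `ℂ = ℝ²` (polar coordinates:
`∫_{|z| ≤ R} |log|z|| dz = 2π ∫₀^R r |log r| dr < ∞`), hence the logarithmic kernel
`log |w - z| ρ(z) ρ'(w)` is integrable on `ℂ × ℂ` for bounded compactly supported densities.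
[folklore] This is the integrability behind the Dirichlet energy
`∬ G_{ℝ²}(u,v) ρ(u) ρ(v) du dv`, `G_{ℝ²}(u,v) = -(2π)⁻¹ log |v - u|` of
H. Duminil-Copin, K. K. Kozlowski, P. Lammers, I. Manolescu, arXiv:2603.06268 (2026), Def. 2.6.
[cite: DKLM2026SixVertexGFF, Def. 2.6]
-/

noncomputable section

open MeasureTheory Set Filter Topology Metric

namespace Literature.Analysis.SpecialFunctions

/-- `r |log r| ≤ R² + 1` for `0 < r ≤ R`. [folklore] -/
theorem mul_abs_log_le {r R : ℝ} (hr : 0 < r) (hrR : r ≤ R) : r * |Real.log r| ≤ R ^ 2 + 1 := by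
  rcases le_or_gt r 1 with h1 | h1
  · -- `-r log r ≤ 1 - r ≤ 1`
    have hlog : Real.log r ≤ 0 := Real.log_nonpos hr.le h1
    rw [abs_of_nonpos hlog]
    have h := Real.log_le_sub_one_of_pos (inv_pos.2 hr)
    rw [Real.log_inv] at h
    have : r * -Real.log r ≤ r * (r⁻¹ - 1) := mul_le_mul_of_nonneg_left h hr.le
    rw [mul_sub, mul_inv_cancel₀ hr.ne', mul_one] at this
    nlinarith [sq_nonneg R]
  · have hlog : 0 ≤ Real.log r := Real.log_nonneg h1.le
    rw [abs_of_nonneg hlog]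
    have h2 : Real.log r ≤ r := Real.log_le_self hr.le
    have h3 : r * Real.log r ≤ r * r := mul_le_mul_of_nonneg_left h2 hr.le
    nlinarith

/-- **`∫_{|z| ≤ R} |log |z|| dz < ∞`** (polar coordinates). [folklore] -/
theorem lintegral_enorm_log_norm_closedBall_lt_top (R : ℝ) :
    ∫⁻ z in closedBall (0 : ℂ) R, ‖Real.log ‖z‖‖ₑ < ⊤ := by
  rw [← lintegral_indicator measurableSet_closedBall, ← Complex.lintegral_comp_polarCoord_symm]
  -- on the polar target the integrand is `r ‖log r‖ₑ 𝟙_{r ≤ R} ≤ (R²+1) 𝟙_{(0,R] × (-π,π)}`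
  have hbound : ∀ p ∈ Complex.polarCoord.target,
      ENNReal.ofReal p.1 • (closedBall (0 : ℂ) R).indicator (fun z => ‖Real.log ‖z‖‖ₑ) (Complex.polarCoord.symm p) ≤
        (Ioc (0 : ℝ) R ×ˢ Ioo (-Real.pi) Real.pi).indicator (fun _ => ENNReal.ofReal (R ^ 2 + 1)) p := by
    intro p hp
    rw [Complex.polarCoord_target, mem_prod, mem_Ioi] at hp
    have hnorm : ‖Complex.polarCoord.symm p‖ = p.1 := by rw [Complex.norm_polarCoord_symm, abs_of_pos hp.1]
    by_cases hR : p.1 ≤ R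
    · have hmem : Complex.polarCoord.symm p ∈ closedBall (0 : ℂ) R := by
        rw [mem_closedBall, dist_zero_right, hnorm]; exact hR
      rw [indicator_of_mem hmem, indicator_of_mem (show p ∈ Ioc (0 : ℝ) R ×ˢ Ioo (-Real.pi) Real.pi from
        ⟨⟨hp.1, hR⟩, hp.2⟩), hnorm, smul_eq_mul]
      rw [Real.enorm_eq_ofReal_abs, ← ENNReal.ofReal_mul hp.1.le]
      exact ENNReal.ofReal_le_ofReal (mul_abs_log_le hp.1 hR)
    · have hmem : Complex.polarCoord.symm p ∉ closedBall (0 : ℂ) R := by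
        rw [mem_closedBall, dist_zero_right, hnorm]; exact hR
      rw [indicator_of_notMem hmem, smul_zero]
      exact bot_le
  calc ∫⁻ p in Complex.polarCoord.target,
        ENNReal.ofReal p.1 • (closedBall (0 : ℂ) R).indicator (fun z => ‖Real.log ‖z‖‖ₑ) (Complex.polarCoord.symm p)
      ≤ ∫⁻ p in Complex.polarCoord.target,
          (Ioc (0 : ℝ) R ×ˢ Ioo (-Real.pi) Real.pi).indicator (fun _ => ENNReal.ofReal (R ^ 2 + 1)) p :=
        setLIntegral_mono' (by rw [Complex.polarCoord_target]; exact measurableSet_Ioi.prod measurableSet_Ioo) hbound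
    _ ≤ ∫⁻ p, (Ioc (0 : ℝ) R ×ˢ Ioo (-Real.pi) Real.pi).indicator (fun _ => ENNReal.ofReal (R ^ 2 + 1)) p :=
        setLIntegral_le_lintegral _ _
    _ = ENNReal.ofReal (R ^ 2 + 1) * volume (Ioc (0 : ℝ) R ×ˢ Ioo (-Real.pi) Real.pi) := by
        rw [lintegral_indicator (measurableSet_Ioc.prod measurableSet_Ioo), setLIntegral_const]
    _ < ⊤ := by
        rw [Measure.volume_eq_prod, Measure.prod_prod, Real.volume_Ioc, Real.volume_Ioo]
        exact ENNReal.mul_lt_top ENNReal.ofReal_lt_top (ENNReal.mul_lt_top ENNReal.ofReal_lt_top ENNReal.ofReal_lt_top)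

/-- **`z ↦ log |z|` is integrable on every disc of `ℂ`.** [folklore] -/
theorem integrableOn_log_norm_closedBall (R : ℝ) :
    IntegrableOn (fun z : ℂ => Real.log ‖z‖) (closedBall (0 : ℂ) R) := by
  refine ⟨(Real.measurable_log.comp measurable_norm).aestronglyMeasurable, ?_⟩
  rw [hasFiniteIntegral_iff_enorm]
  exact lintegral_enorm_log_norm_closedBall_lt_top R

/-- **The planar logarithmic kernel is integrable against bounded compactly supported
densities:** `(z, w) ↦ log |w - z| ρ(z) ρ'(w)` is integrable on `ℂ × ℂ`. [folklore] -/
theorem integrable_log_norm_sub_mul {ρ ρ' : ℂ → ℝ} (hρ : Continuous ρ) (hs : HasCompactSupport ρ)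
    (hρ' : Continuous ρ') (hs' : HasCompactSupport ρ') :
    Integrable (fun p : ℂ × ℂ => Real.log ‖p.2 - p.1‖ * (ρ p.1 * ρ' p.2)) (volume.prod volume) := by
  obtain ⟨R, hR⟩ := hs.isCompact.isBounded.subset_closedBall 0
  obtain ⟨R', hR'⟩ := hs'.isCompact.isBounded.subset_closedBall 0
  obtain ⟨M', hM'⟩ := hs'.exists_bound_of_continuous hρ'
  -- shear `(z, w) ↦ (z, w - z)`: it suffices to treat `F(z, t) = log |t| ρ(z) ρ'(z + t)`
  set F : ℂ × ℂ → ℝ := fun q => Real.log ‖q.2‖ * (ρ q.1 * ρ' (q.1 + q.2)) with hF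
  have hS := measurePreserving_prod_sub (volume : Measure ℂ) (volume : Measure ℂ)
  have hFm : AEStronglyMeasurable F (volume.prod volume) := by
    refine Measurable.aestronglyMeasurable ?_
    exact ((Real.measurable_log.comp measurable_norm).comp measurable_snd).mul
      ((hρ.measurable.comp measurable_fst).mul (hρ'.measurable.comp (measurable_fst.add measurable_snd)))
  have hcomp : (fun p : ℂ × ℂ => Real.log ‖p.2 - p.1‖ * (ρ p.1 * ρ' p.2)) = F ∘ fun z : ℂ × ℂ => (z.1, z.2 - z.1) := by
    funext p
    simp only [hF, Function.comp_apply, add_sub_cancel]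
  rw [hcomp, hS.integrable_comp hFm]
  -- `|F(z,t)| ≤ (M' |ρ z|) · (|log |t|| 𝟙_{|t| ≤ |R| + |R'|})`
  have hI1 : Integrable (fun z : ℂ => |M'| * |ρ z|) volume := (hρ.integrable_of_hasCompactSupport hs).abs.const_mul |M'|
  have hI2 : Integrable (fun t : ℂ => (closedBall (0 : ℂ) (|R| + |R'|)).indicator (fun t => |Real.log ‖t‖|) t) volume := by
    rw [integrable_indicator_iff measurableSet_closedBall]
    exact (integrableOn_log_norm_closedBall (|R| + |R'|)).abs
  refine (hI1.mul_prod hI2).mono' hFm (Eventually.of_forall fun q => ?_)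
  rw [Real.norm_eq_abs]
  simp only [hF]
  have hnn : (0 : ℝ) ≤ |M'| * |ρ q.1| * (closedBall (0 : ℂ) (|R| + |R'|)).indicator (fun t => |Real.log ‖t‖|) q.2 :=
    mul_nonneg (by positivity) (Set.indicator_nonneg (fun t _ => abs_nonneg _) _)
  by_cases hz : ρ q.1 = 0
  · simp [hz]
  by_cases hw : ρ' (q.1 + q.2) = 0
  · simpa [hw] using hnn
  have hz' : ‖q.1‖ ≤ |R| := by
    have : q.1 ∈ closedBall (0 : ℂ) R := hR (subset_tsupport _ (Function.mem_support.2 hz))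
    rw [mem_closedBall, dist_zero_right] at this
    exact this.trans (le_abs_self R)
  have hw' : ‖q.1 + q.2‖ ≤ |R'| := by
    have : q.1 + q.2 ∈ closedBall (0 : ℂ) R' := hR' (subset_tsupport _ (Function.mem_support.2 hw))
    rw [mem_closedBall, dist_zero_right] at this
    exact this.trans (le_abs_self R')
  have ht : q.2 ∈ closedBall (0 : ℂ) (|R| + |R'|) := by
    rw [mem_closedBall, dist_zero_right]
    calc ‖q.2‖ = ‖(q.1 + q.2) - q.1‖ := by ring_nf
      _ ≤ ‖q.1 + q.2‖ + ‖q.1‖ := norm_sub_le _ _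
      _ ≤ |R'| + |R| := add_le_add hw' hz'
      _ = |R| + |R'| := add_comm _ _
  rw [indicator_of_mem ht, abs_mul, abs_mul]
  have hρ'b : |ρ' (q.1 + q.2)| ≤ |M'| := by
    have := hM' (q.1 + q.2)
    rw [Real.norm_eq_abs] at this
    exact this.trans (le_abs_self M')
  have h0 : 0 ≤ |Real.log ‖q.2‖| := abs_nonneg _
  calc |Real.log ‖q.2‖| * (|ρ q.1| * |ρ' (q.1 + q.2)|) ≤ |Real.log ‖q.2‖| * (|ρ q.1| * |M'|) := by gcongr
    _ = |M'| * |ρ q.1| * |Real.log ‖q.2‖| := by ring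

end Literature.Analysis.SpecialFunctions

end
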